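import Summits.Ventures.HSemireg.WedgeHankelCoSiegel
import Summits.Ventures.HSemireg.WedgeHankelDivisorTopGeneric

/-!
# Venture HSemireg — THE CO-SIEGEL DECOMPOSITION: for ANY divisor on `P¹` of total order exactly `k + 1` (`2k ≤ n`), the co-Siegel space `coSiegel(2n − k)` is the
# DIRECT SUM of the images of the divisor's nodes — dual to gen 14's «`SI_k` is the intersection of any `k + 1` frame ideals»

HONEST FRAMING. Part of the Lean index of the computation cell `pub-hsemireg` (seat p10 gen 16, Sunday typer «UNIFORM-IN-n»).
Finite-dimensional EXTERIOR ALGEBRA over a field ONLY: no variety, no cohomology theory, no sheaf, no Ext group, no semiregularity map;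
nothing here says that HC / HC_CM / HC_AV holds; no Literature fact is declared or used.  Custodian versions as in `WedgeHankelSiegelIdeal` (1/3) and `WedgeKernelDuality`;
the dictionary is QUOTED, never asserted.

WHAT IS IN THE TREE / KEYED.  F4 (`coSiegel`, `V_w_eq_coSiegel_of_rank`: a class of full Hankel rank `k + 1` in degree `k` has image `coSiegel(n + k′)` on `⋀^{k′}`, `k + k′ = n`);
F2c/F3c (`rank H_k = min(D, k+1)`); F2d/F3c (the image of a divisor class is the direct sum of its node images); D3 (`iInf_frameIdeal_eq_siegelIdeal`: `SI_k = ⋂` of any `k+1`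
frame ideals, `2k ≤ n`).  THIS FILE puts them together:
* §72 **`coSiegel_eq_iSup_V_expMul`**: for distinct finite nodes `λ_i` with exact orders `P_i` and `Σ_i (P_i + 1) = k + 1`, `2k ≤ n`, `k + k′ = n`:
  **`coSiegel(k′ + n) = ⨆_i V(univ, w_n(expMul λ_i q_i), k′)`**, and the sum is DIRECT (`iSupIndep`, F2d) — every co-Siegel form of degree `2n − k` is uniquely a sum of
  multiples `θ_i ∧ (node class i)`, `θ_i ∈ ⋀^{k′}`; all `P_i = 0`: **`coSiegel_eq_iSup_V_exp`** — `k + 1` distinct PURE classes `u^{λ_i}`-volumes span the co-Siegel space directly.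
* §73 the same with a node at `∞` in the divisor (**`coSiegel_eq_iSup_V_sup_V_rev`**, F3c).
Class side only.  Namespace `Summit.Ventures.HSemireg.Wedge.KernelDuality` (continued); new names only.
-/

open Module

namespace Summit.Ventures.HSemireg.Wedge.KernelDuality

open Summit.Ventures.HSemireg.Wedge Summit.Ventures.HSemireg.Wedge.Kunneth Summit.Ventures.HSemireg.Wedge.Hankel
  Summit.Ventures.HSemireg.Wedge.HankelSiegel Summit.Ventures.HSemireg.Wedge.HankelSiegelIdeal Summit.Ventures.HSemireg.Wedge.KunnethKernel
  Summit.Ventures.HSemireg.Wedge.HankelSecant Summit.Ventures.HSemireg.Wedge.HankelFrameChange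

variable (K : Type*) [Field K] {n : ℕ}

/-! ## §72. Finite divisors of total order `k + 1` -/

/-- **THE CO-SIEGEL DECOMPOSITION (finite divisor)**: distinct `λ_i`, `q_i` of exact orders `P_i` with `Σ_i (P_i + 1) = k + 1`, `2k ≤ n`, `k + k′ = n` ⇒
**`coSiegel(k′ + n) = ⨆_i V(univ, w_n(expMul λ_i q_i), k′)`** — and the sum is direct (`iSupIndep_V_w_expMul` of F2d, restated below). -/
theorem coSiegel_eq_iSup_V_expMul {k k' r : ℕ} (hkk' : k + k' = n) (hk2 : k + k ≤ n) {lam : Fin r → K} (hlam : Function.Injective lam) {P : Fin r → ℕ}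
    {q : Fin r → ℕ → K} (hq : ∀ i j, P i < j → q i j = 0) (hqP : ∀ i, q i (P i) ≠ 0) (hD : ∑ i, (P i + 1) = k + 1) :
    coSiegel K n (k' + n) = ⨆ i, V K (In n) Finset.univ (w K n n (expMul K (lam i) (q i))) k' := by
  have hrank : (hankel1 K n k (fun j => ∑ i, expMul K (lam i) (q i) j)).rank = k + 1 := by
    rw [rank_hankel1_expMul_sum_eq_min K hlam hq hqP (by omega), hD, min_self]
  rw [← V_w_eq_coSiegel_of_rank K hkk' hrank]
  exact (V_w_expMul_sum K hlam hq hqP (by omega) (by omega)).1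

/-- … the sum is DIRECT (F2d), restated in the co-Siegel range. -/
theorem iSupIndep_V_w_expMul_coSiegel {k k' r : ℕ} (hkk' : k + k' = n) (hk2 : k + k ≤ n) {lam : Fin r → K} (hlam : Function.Injective lam) {P : Fin r → ℕ}
    {q : Fin r → ℕ → K} (hq : ∀ i j, P i < j → q i j = 0) (hqP : ∀ i, q i (P i) ≠ 0) (hD : ∑ i, (P i + 1) = k + 1) :
    iSupIndep (fun i => V K (In n) Finset.univ (w K n n (expMul K (lam i) (q i))) k') :=
  iSupIndep_V_w_expMul K hlam hq hqP (by omega) (by omega)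

/-- **`k + 1` DISTINCT PURE CLASSES SPAN THE CO-SIEGEL SPACE DIRECTLY: `coSiegel(k′ + n) = ⨆_{i ≤ k} V(univ, w_n(A_i λ_i^•), k′)`** for distinct `λ_0, …, λ_k`, `A_i ≠ 0`, `2k ≤ n`,
`k + k′ = n` — every form killed by all Siegel 2-vectors is uniquely `Σ_i θ_i ∧ (A_i · u^{λ_i}_0 ∧ ⋯ ∧ u^{λ_i}_{n−1})` with `θ_i ∈ ⋀^{k′}`; dual to gen 14's `SI_k = ⋂_{i ≤ k} F_{λ_i}(k)`. -/
theorem coSiegel_eq_iSup_V_exp {k k' : ℕ} (hkk' : k + k' = n) (hk2 : k + k ≤ n) {lam : Fin (k + 1) → K} (hlam : Function.Injective lam) {A : Fin (k + 1) → K}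
    (hA : ∀ i, A i ≠ 0) :
    coSiegel K n (k' + n) = ⨆ i, V K (In n) Finset.univ (w K n n (fun j => A i * lam i ^ j)) k' ∧
      iSupIndep (fun i => V K (In n) Finset.univ (w K n n (fun j => A i * lam i ^ j)) k') := by
  have e : ∀ i, (fun j => A i * lam i ^ j) = expMul K (lam i) (fun t => if t = 0 then A i else 0) := fun i =>
    funext fun j => (expMul_spike_zero K (lam i) (A i) j).symm
  have hD : ∑ i : Fin (k + 1), ((fun _ => 0 : Fin (k + 1) → ℕ) i + 1) = k + 1 := by simp
  simp only [e]
  exact ⟨coSiegel_eq_iSup_V_expMul K hkk' hk2 hlam (P := fun _ => 0) (fun i j hj => if_neg (by omega)) (fun i => by rw [if_pos rfl]; exact hA i) hD,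
    iSupIndep_V_w_expMul_coSiegel K hkk' hk2 hlam (P := fun _ => 0) (fun i j hj => if_neg (by omega)) (fun i => by rw [if_pos rfl]; exact hA i) hD⟩

/-- the dimension bookkeeping: `(k + 1)·C(n,k) = Σ_{i ≤ k} C(n,k′)` hidden in the above — each pure image has dimension `C(n,k′) = C(n,k)`. -/
theorem finrank_V_w_exp {k k' : ℕ} (hkk' : k + k' = n) (lam : K) {A : K} (hA : A ≠ 0) :
    finrank K (V K (In n) Finset.univ (w K n n (fun j => A * lam ^ j)) k') = n.choose k := by
  have e : (fun j => A * lam ^ j) = expMul K lam (fun t => if t = 0 then A else 0) := funext fun j => (expMul_spike_zero K lam A j).symm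
  rw [e, finrank_V_w_expMul_of_order K lam (P := 0) (Nat.zero_le _) (by omega) (fun j hj => if_neg (by omega)) (by rw [if_pos rfl]; exact hA), zero_add, one_mul,
    ← Nat.choose_symm (show k ≤ n by omega), show n - k = k' by omega]

/-! ## §73. Divisors on `P¹` of total order `k + 1` -/

/-- **THE CO-SIEGEL DECOMPOSITION ON `P¹`**: distinct finite `λ_i` of exact orders `P_i`, a node at `∞` of exact order `P∞`, `Σ_i (P_i+1) + (P∞+1) = k + 1`, `2k ≤ n`, `k + k′ = n`
⇒ **`coSiegel(k′ + n) = (⨆_i V(univ, w_n(expMul λ_i q_i), k′)) ⊔ V(univ, w_n(rev_n q∞), k′)`**, the node at `∞` meeting the finite part in `0` (F3c). -/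
theorem coSiegel_eq_iSup_V_sup_V_rev {k k' r : ℕ} (hkk' : k + k' = n) (hk2 : k + k ≤ n) {lam : Fin r → K} (hlam : Function.Injective lam) {P : Fin r → ℕ}
    {q : Fin r → ℕ → K} (hq : ∀ i j, P i < j → q i j = 0) (hqP : ∀ i, q i (P i) ≠ 0) {Pinf : ℕ} {qinf : ℕ → K} (hqi : ∀ j, Pinf < j → qinf j = 0)
    (hqiP : qinf Pinf ≠ 0) (hD : ∑ i, (P i + 1) + (Pinf + 1) = k + 1) :
    coSiegel K n (k' + n) = (⨆ i, V K (In n) Finset.univ (w K n n (expMul K (lam i) (q i))) k') ⊔ V K (In n) Finset.univ (w K n n (rev K n qinf)) k' ∧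
      Disjoint (⨆ i, V K (In n) Finset.univ (w K n n (expMul K (lam i) (q i))) k') (V K (In n) Finset.univ (w K n n (rev K n qinf)) k') := by
  have hrank : (hankel1 K n k (fun j => (∑ i, expMul K (lam i) (q i) j) + rev K n qinf j)).rank = k + 1 := by
    rw [rank_hankel1_expMul_sum_add_rev_eq_min K hlam hq hqP hqi hqiP (by omega), hD, min_self]
  refine ⟨?_, iSup_V_w_expMul_disjoint_rev K hlam hq hqP hqi hqiP (by omega) (by omega)⟩
  rw [← V_w_eq_coSiegel_of_rank K hkk' hrank]
  exact (V_w_expMul_sum_add_rev K hlam hq hqP hqi hqiP (by omega) (by omega)).1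

/-- **`k` DISTINCT PURE CLASSES AND THE POINT**: `coSiegel(k′ + n) = (⨆_{i < k} V(univ, w_n(A_i λ_i^•), k′)) ⊔ V(univ, w_n(c·δ_n), k′)` (`2k ≤ n`, `k + k′ = n`, `A_i, c ≠ 0`). -/
theorem coSiegel_eq_iSup_V_exp_sup_V_point {k k' : ℕ} (hkk' : k + k' = n) (hk2 : k + k ≤ n) {lam : Fin k → K} (hlam : Function.Injective lam) {A : Fin k → K}
    (hA : ∀ i, A i ≠ 0) {c : K} (hc : c ≠ 0) :
    coSiegel K n (k' + n) = (⨆ i, V K (In n) Finset.univ (w K n n (fun j => A i * lam i ^ j)) k') ⊔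
      V K (In n) Finset.univ (w K n n (rev K n (fun t => if t = 0 then c else 0))) k' := by
  have e : ∀ i, (fun j => A i * lam i ^ j) = expMul K (lam i) (fun t => if t = 0 then A i else 0) := fun i =>
    funext fun j => (expMul_spike_zero K (lam i) (A i) j).symm
  have hD : ∑ i : Fin k, ((fun _ => 0 : Fin k → ℕ) i + 1) + (0 + 1) = k + 1 := by simp
  simp only [e]
  exact (coSiegel_eq_iSup_V_sup_V_rev K hkk' hk2 hlam (P := fun _ => 0) (fun i j hj => if_neg (by omega)) (fun i => by rw [if_pos rfl]; exact hA i)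
    (Pinf := 0) (fun j hj => if_neg (by omega)) (by rw [if_pos rfl]; exact hc) hD).1

end Summit.Ventures.HSemireg.Wedge.KernelDuality
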